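import Summits.QuantumFields.YangMills.Theorems.BalabanUVNodesPortU8GenericRow
import Summits.QuantumFields.YangMills.Theorems.BalabanUVNodesPortU8CurrentLinearisation
import Summits.QuantumFields.YangMills.Theorems.BalabanUVNodesPortU8Response9
import Summits.QuantumFields.YangMills.Theorems.BalabanUVNodesK0RecordFormatNamesLemmas9

/-!
# PORT PT-B (U8), g2 file 6 — THE (C1′) ROWS AT THE ed.14 LANDAU NAMES: `recordGkL`'s `𝐔`-block chart matrix IS `Matrix.of (recordHr … b)` (tracelessness of the (21)-Landau
# representative), its `𝐉`-block IS the rooted one and is bounded by (190)'s fourth clause ON `recordHr` (since `recordD = recordHr + dφ`, ✓Lemmas9), hence ROW (R1ᴰ) for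
# `recordGkL` from the four clauses of ⁷‴'s TokP9L4‴ token, and the `Response9D` FRAME for `recordResponse9DataFromL` — `--supports stmt-QuantumFields-27931` (helper; NOT a closer)

Cell `ym-nodeO-ideate` ∕ `ym-balaban-port`, porter `ymgap-nodeO-port-PTB-1` (gen 2), item **stmt-QuantumFields-27931** `BalabanUVNodes.PortPieceLocalityU8`; RC-2 (CRIT-1 Q-12 UPHELD,
Q-12b X1′; DEF-1 ed.14 ✓ `…K0RecordFormatNamesL` + ✓ `…Lemmas9`; candidate ⁷‴ (A) `nodeO-cover/CRIT-1-Expect27931-U8tp-A-letI.txt` ce176c419bf63055).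
[I] = [Balaban1987RG1], [15] = [Balaban1985Variational].
WHAT IS PROVED (0 `sorry`, 0 `def`; standard axioms):
§1 `recordD_trace` (the rooted response is traceless — `det ≡ 1`, or `fderiv = 0`); ★ `recordHr_trace` (so is its Landau representative: DEF-1's ✓`trace_recordHr_eq_zero`,
   the re-gauging being ℝ-linear entry by entry, ✓Lemmas9 v2 §4).
§2 ★★ `chartMatU_cutTo_recordGkL` — on `b ∈ X` the `𝐔`-block chart matrix of `cutTo (recordCXJ X) (recordGkL … a y)` is `Matrix.of (recordHr … a y b)`; `0` off `X`.
§3 `chartMatJc_cutTo_recordGkL_eq` (the `𝐉`-block is `recordGkJ`'s) and ★★ `norm_chartMatJc_cutTo_recordGkL_le` — under TokP9reg (rooted entries `C²` at `0`): the `𝐉`-block is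
   bounded by `2‖π_ℝ‖ξ⁻³·t` from the fourth (190)-clause `‖d*d recordHr (b)‖ ≤ t` (file 2 port M + ✓`recordD_eq_recordHr_add` + `curlF_of_exact`).
§4 ★★★ `rowR1D_L_at` — ROW (R1ᴰ) for the L-response at one (volume, X, y): the three clauses + the fourth on `recordHr … a y` (ONE constant `C`, ONE rate `δ₉` — ⁷‴'s token shape)
   give `gauge (recordDom44J … X α₂) (cutTo … (recordGkL … a y)) ≤ 2(2C + 2‖π_ℝ‖C + 1)e^{4δ₉Mc}∕α₂ · e^{−δ₉·dist(y,X)}` (generic row ✓p800724).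
§5 `response9D_fromL_of_decayRows` — the `Response9D` frame for `recordResponse9DataFromL` from its two decay rows ((R0)(R3)(R5) discharged by ✓p796246, fields identical).
HONEST FRAMING.  Transport at the names; the decay clauses are HYPOTHESES (⁷‴'s displayed token); NOTHING of Bałaban asserted; 27931 OPEN (CLOSE HOLD until ⁷‴ is signed and
rendered; then closable modulo (R4ᴰ) only); K0⁷ NOT closed; NODE O 0∕1; COUNT 8∕28 · K 1∕4 UNMOVED; finite `𝕋⁴_{L^K}` at fixed ε — NOT continuum ∕ OS ∕ Clay;
**the Yang–Mills mass gap (Clay) is NOT proved.**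
-/

noncomputable section

open scoped BigOperators Matrix.Norms.L2Operator

namespace Summit.QuantumFields.YangMills.Theorems.PortU8

open Literature.MathematicalPhysics.QuantumFieldTheory.Balaban1983to89
open Literature.MathematicalPhysics.QuantumFieldTheory.Balaban1983to89.Node00
open Literature.MathematicalPhysics.QuantumFieldTheory.Balaban1983to89.T4Continuum (T4Family)
open Summit.QuantumFields.YangMills.Theorems.K0RecordFormatNames

variable (F : T4Family)

/-! ## §1  Tracelessness of the rooted response and of its Landau representative -/

variable (θ : Stage13Params F 2)

/-- **The rooted response is TRACELESS**: `recordD … b 0 0 + recordD … b 1 1 = 0` — either the entry map is differentiable at `0` and `det U ≡ 1` linearises to `tr = 0`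
(✓`trace_eq_zero_of_hasFDerivAt_su`), or it is not and `fderiv = 0`.  (Standing range, `0 < εbg`, so `U_{k+1}(W_0) = 1`.) [cite: Balaban1985Variational, (182) p.307 (bookkeeping)] -/
theorem recordD_trace (k K : ℕ) (hk : k + 1 ≤ (F.P K).m + (F.P K).K) (hε : 0 < θ.εbg) (a : θ.ιβ) (l : RespLabel F k K) (b : PBond (F.P K) 0) :
    recordD F θ k K a l b 0 0 + recordD F θ k K a l b 1 1 = 0 := by
  letI := θ.instVβ₁; letI := θ.instVβ₂; letI := θ.instιβ
  by_cases hd : DifferentiableAt ℝ (fun B : Fin (F.P K).d → Site (F.P K) (k + 1) → θ.Vβ =>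
      fun (b : PBond (F.P K) 0) (i i' : Fin 2) => ((recordBgField F θ k K B b : SU 2) : MatA 2) i i') 0
  · obtain ⟨U', hU'eq, hU'⟩ := hasFDerivAt_bgField_of_entries F θ k K hd
    have hUb : HasFDerivAt (fun B : Fin (F.P K).d → Site (F.P K) (k + 1) → θ.Vβ => ((recordBgField F θ k K B b : SU 2) : MatA 2))
        ((ContinuousLinearMap.proj b).comp U') 0 := (hasFDerivAt_pi'.1 hU') b
    have h1 : recordBgField F θ k K 0 b = 1 := by rw [recordBgField_zero F θ k K hk hε]; rfl
    have htr := trace_eq_zero_of_hasFDerivAt_su hUb h1 (Pi.single l.1 (Pi.single l.2 (θ.bV a)))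
    rw [ContinuousLinearMap.comp_apply, ContinuousLinearMap.proj_apply, hU'eq, Matrix.trace_fin_two, Matrix.of_apply, Matrix.of_apply] at htr
    exact htr
  · have h0 : fderiv ℝ (fun B : Fin (F.P K).d → Site (F.P K) (k + 1) → θ.Vβ =>
        fun (b : PBond (F.P K) 0) (i i' : Fin 2) => ((recordBgField F θ k K B b : SU 2) : MatA 2) i i') 0 = 0 := fderiv_zero_of_not_differentiableAt hd
    show fderiv ℝ (fun B : Fin (F.P K).d → Site (F.P K) (k + 1) → θ.Vβ =>
        fun (b : PBond (F.P K) 0) (i i' : Fin 2) => ((recordBgField F θ k K B b : SU 2) : MatA 2) i i') 0 (Pi.single l.1 (Pi.single l.2 (θ.bV a))) b 0 0 +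
      fderiv ℝ (fun B : Fin (F.P K).d → Site (F.P K) (k + 1) → θ.Vβ =>
        fun (b : PBond (F.P K) 0) (i i' : Fin 2) => ((recordBgField F θ k K B b : SU 2) : MatA 2) i i') 0 (Pi.single l.1 (Pi.single l.2 (θ.bV a))) b 1 1 = 0
    rw [h0]
    simp only [zero_apply, Pi.zero_apply, add_zero]

/-- ★ **The (21)-Landau representative of the response is TRACELESS**: `tr (Matrix.of (recordHr … b)) = 0` (DEF-1's ✓`trace_recordHr_eq_zero` fed with `recordD_trace`).
[cite: Balaban1985Variational, (21) p.281, (182) p.307 (bookkeeping)] -/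
theorem recordHr_trace (k K : ℕ) (hk : k + 1 ≤ (F.P K).m + (F.P K).K) (hε : 0 < θ.εbg) (a : θ.ιβ) (l : RespLabel F k K) (b : PBond (F.P K) 0) :
    Matrix.trace (Matrix.of fun i i' => recordHr F θ k K a l b i i') = 0 := by
  refine trace_recordHr_eq_zero F θ k K a l (fun b' => ?_) b
  rw [Matrix.trace_fin_two, Matrix.of_apply, Matrix.of_apply]
  exact recordD_trace F θ k K hk hε a l b'

/-! ## §2  The `𝐔`-block chart matrix of the cut L-response -/

open scoped Classical in
/-- ★★ **`𝐔`-BLOCK OF THE CUT L-RESPONSE = `Matrix.of (recordHr … b)` on `b ∈ X`**, `0` off `X`. [cite: Balaban1987RG1, (4.4) p.281, (4.35) p.290; Balaban1985Variational, (21) p.281] -/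
theorem chartMatU_cutTo_recordGkL (k K : ℕ) (hk : k + 1 ≤ (F.P K).m + (F.P K).K) (hε : 0 < θ.εbg) (a : θ.ιβ) (y : RespLabel F k K)
    {Mc : ℕ} (X : (recordDomSys F Mc k K).Dom) (b : PBond (F.P K) 0) :
    chartMatU F K (B12FormatPlus.cutTo (recordCXJ F Mc k K X) (recordGkL F θ k K a y)) b =
      if b ∈ domBonds F Mc k K X then Matrix.of (fun i i' => recordHr F θ k K a y b i i') else 0 := by
  classical
  have hmem : ∀ c : Fin 3, chartEquivJ F K (b, Sum.inl c) ∈ recordCXJ F Mc k K X ↔ b ∈ domBonds F Mc k K X := fun c => by simp [recordCXJ]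
  by_cases hb : b ∈ domBonds F Mc k K X
  · rw [if_pos hb]
    have htr : (Matrix.of (fun i i' => recordHr F θ k K a y b i i') : MatA 2).trace = 0 := recordHr_trace F θ k K hk hε a y b
    rw [← sum_sl2Coord_smul_sl2Gen_of_trace_eq_zero htr]
    unfold chartMatU
    refine Finset.sum_congr rfl fun c _ => ?_
    rw [B12FormatPlus.cutTo_apply, if_pos ((hmem c).2 hb), recordGkL_inl]
  · rw [if_neg hb]
    unfold chartMatU
    refine Finset.sum_eq_zero fun c _ => ?_
    rw [B12FormatPlus.cutTo_apply, if_neg (mt (hmem c).1 hb), zero_smul]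

/-! ## §3  The `𝐉`-block of the cut L-response and its bound from the fourth clause on `recordHr` -/

open scoped Classical in
/-- The `𝐉`-block chart matrix of the cut L-response is that of the cut ROOTED response (the `𝐉`-coordinates are unchanged by construction).
[cite: Balaban1987RG1, (1.8)–(1.9) p.261 (bookkeeping)] -/
theorem chartMatJc_cutTo_recordGkL_eq (k K : ℕ) (a : θ.ιβ) (y : RespLabel F k K) {Mc : ℕ} (X : (recordDomSys F Mc k K).Dom) (b : PBond (F.P K) 0) :
    chartMatJc F K (B12FormatPlus.cutTo (recordCXJ F Mc k K X) (recordGkL F θ k K a y)) b =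
      chartMatJc F K (B12FormatPlus.cutTo (recordCXJ F Mc k K X) (recordGkJ F θ k K a y)) b := by
  classical
  unfold chartMatJc
  refine Finset.sum_congr rfl fun c _ => ?_
  rw [B12FormatPlus.cutTo_apply, B12FormatPlus.cutTo_apply, recordGkL_inr]

/-- ★★ **THE `𝐉`-BLOCK OF THE CUT L-RESPONSE BOUNDED BY THE FOURTH (190)-CLAUSE ON `recordHr`** (TokP9reg: rooted entries `C²` at `0`; standing range, `0 < εbg`): if
`‖Σ_ν [(d Hr)(p_{μν}(x)) − (d Hr)(p_{μν}(x − e_ν))]‖ ≤ t` at `b = (x, μ) ∈ X`, `Hr = recordHr … a y`, then `‖chartMatJc (cutTo (recordCXJ X) (recordGkL … a y)) b‖ ≤ 2·‖π_ℝ‖·ξ⁻³·t`.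
(`d*d recordD = d*d recordHr` by ✓`recordD_eq_recordHr_add` + `curlF_of_exact`; port M ✓p799978.) [cite: Balaban1987RG1, (1.8) p.261, (4.4) p.281; Balaban1985Variational, (190) p.308, (21) p.281] -/
theorem norm_chartMatJc_cutTo_recordGkL_le (k K : ℕ) (hk : k + 1 ≤ (F.P K).m + (F.P K).K) (hε : 0 < θ.εbg)
    (hd2 : letI := θ.instVβ₁; letI := θ.instVβ₂;
      ContDiffAt ℝ 2 (fun B : Fin (F.P K).d → Site (F.P K) (k + 1) → θ.Vβ =>
        fun (b : PBond (F.P K) 0) (i i' : Fin 2) => ((recordBgField F θ k K B b : SU 2) : MatA 2) i i') 0)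
    (a : θ.ιβ) (y : RespLabel F k K) {Mc : ℕ} (X : (recordDomSys F Mc k K).Dom) (b : PBond (F.P K) 0) (hb : b ∈ domBonds F Mc k K X) {t : ℝ}
    (h4 : letI Hr := recordHr F θ k K a y;
      ‖∑ ν : Fin (F.P K).d, ((Hr ⟨b.src, b.dir⟩ + Hr ⟨(b.src).shift b.dir, ν⟩ - Hr ⟨(b.src).shift ν, b.dir⟩ - Hr ⟨b.src, ν⟩) -
        (Hr ⟨b.src.unshift ν, b.dir⟩ + Hr ⟨(b.src.unshift ν).shift b.dir, ν⟩ - Hr ⟨(b.src.unshift ν).shift ν, b.dir⟩ - Hr ⟨b.src.unshift ν, ν⟩))‖ ≤ t) :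
    ‖chartMatJc F K (B12FormatPlus.cutTo (recordCXJ F Mc k K X) (recordGkL F θ k K a y)) b‖ ≤
      2 * ‖LinearMap.toContinuousLinearMap (sl2Proj.restrictScalars ℝ)‖ * (((F.P K).eta (k + 1))⁻¹) ^ 3 * t := by
  rw [chartMatJc_cutTo_recordGkL_eq]
  refine norm_chartMatJc_cutTo_recordGkJ_le_of_LR4 F θ k K hk hε hd2 a y X b hb (recordHr F θ k K a y)
    (fun x i i' => -landauPotC F k K (fun b' => recordD F θ k K a y b' i i') x) (fun b' => ?_) h4
  funext i i'
  show recordD F θ k K a y b' i i' = _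
  rw [recordD_eq_recordHr_add]
  simp only [PBond.tgt, Pi.add_apply, Pi.sub_apply]
  ring

/-! ## §4  ROW (R1ᴰ) for the L-response at one (volume, domain, label) from ⁷‴'s four clauses on `recordHr` -/

variable {F} in
/-- ★★★ **ROW (R1ᴰ) FOR THE (21)-LANDAU RESPONSE** at one volume `K` (tiled range), domain `X`, label `y`: if `Hr := recordHr F θ k K a y` obeys the four scaled clauses of (190) —
value `Cη·e_b`, first differences `Cη²·e_b`, Laplacian `Cη³·e_b`, lattice `d*d` `Cη³·e_b`, `e_b = e^{−δ₉·tdist(coarsen b₋, y₀)}` — at every bond (⁷‴'s TokP9L4‴ token at `(a, y.1, y.2)`,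
verbatim shape) and the rooted entries are `C²` at `0` (TokP9reg), then
`gauge (recordDom44J … X α₂) (cutTo (recordCXJ … X) (recordGkL … a y)) ≤ 2(2C + 2‖π_ℝ‖C + 1)e^{4δ₉Mc}∕α₂ · e^{−δ₉·dist(y, X)}` — uniform in `k, K, X, y`.
[cite: Balaban1987RG1, (4.4)–(4.5) pp.281–282; Balaban1985Variational, (190) p.308, (21) p.281] -/
theorem rowR1D_L_at {Mc k K : ℕ} (hMc : McGuard F Mc) (hK : recordK₀ F Mc k ≤ K) (θ : Stage13Params F 2) (hε : 0 < θ.εbg)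
    (hd2 : letI := θ.instVβ₁; letI := θ.instVβ₂;
      ContDiffAt ℝ 2 (fun B : Fin (F.P K).d → Site (F.P K) (k + 1) → θ.Vβ =>
        fun (b : PBond (F.P K) 0) (i i' : Fin 2) => ((recordBgField F θ k K B b : SU 2) : MatA 2) i i') 0)
    (a : θ.ιβ) (y : RespLabel F k K) (X : (recordDomSys F Mc k K).Dom) {α₂ C δ₉ : ℝ} (hα : 0 < α₂) (hC : 0 ≤ C) (hδ : 0 ≤ δ₉)
    (hcl : letI Hr := recordHr F θ k K a y;
      ∀ b : PBond (F.P K) 0,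
        ‖Hr b‖ ≤ C * (F.P K).eta (k + 1) * Real.exp (-(δ₉ * (Site.tdist (coarsenTo (k + 1) b.src) y.2 : ℝ))) ∧
        (∀ ν : Fin (F.P K).d, ‖Hr ⟨b.src.shift ν, b.dir⟩ - Hr b‖ ≤ C * (F.P K).eta (k + 1) ^ 2 * Real.exp (-(δ₉ * (Site.tdist (coarsenTo (k + 1) b.src) y.2 : ℝ)))) ∧
        ‖∑ ν : Fin (F.P K).d, (Hr ⟨b.src.shift ν, b.dir⟩ - (2 : ℂ) • Hr b + Hr ⟨b.src.unshift ν, b.dir⟩)‖ ≤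
          C * (F.P K).eta (k + 1) ^ 3 * Real.exp (-(δ₉ * (Site.tdist (coarsenTo (k + 1) b.src) y.2 : ℝ))) ∧
        ‖∑ ν : Fin (F.P K).d, ((Hr ⟨b.src, b.dir⟩ + Hr ⟨(b.src).shift b.dir, ν⟩ - Hr ⟨(b.src).shift ν, b.dir⟩ - Hr ⟨b.src, ν⟩) -
          (Hr ⟨b.src.unshift ν, b.dir⟩ + Hr ⟨(b.src.unshift ν).shift b.dir, ν⟩ - Hr ⟨(b.src.unshift ν).shift ν, b.dir⟩ - Hr ⟨b.src.unshift ν, ν⟩))‖ ≤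
          C * (F.P K).eta (k + 1) ^ 3 * Real.exp (-(δ₉ * (Site.tdist (coarsenTo (k + 1) b.src) y.2 : ℝ)))) :
    gauge (recordDom44J F Mc k K X α₂) (B12FormatPlus.cutTo (recordCXJ F Mc k K X) (recordGkL F θ k K a y)) ≤
      2 * (2 * C + 2 * ‖LinearMap.toContinuousLinearMap (sl2Proj.restrictScalars ℝ)‖ * C + 1) * Real.exp (4 * δ₉ * Mc) / α₂ *
        Real.exp (-δ₉ * (recordSiteGeom F Mc k K).distD y X) := by
  have hk : k + 1 ≤ (F.P K).m + (F.P K).K := by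
    simp only [T4Family.P_m, T4Family.P_K]; unfold recordK₀ at hK; omega
  have hη0 : 0 < (F.P K).eta (k + 1) := by
    unfold Params.eta; exact pow_pos (inv_pos.2 (F.P K).cast_L_pos) _
  have hπ0 : 0 ≤ 2 * ‖LinearMap.toContinuousLinearMap (sl2Proj.restrictScalars ℝ)‖ * C := by positivity
  refine gauge_recordDom44J_cutTo_le_of_entryDecay F hMc hK X y (recordGkL F θ k K a y) (recordHr F θ k K a y) hα hC hπ0 hδ
    (fun b hb => by rw [chartMatU_cutTo_recordGkL F θ k K hk hε a y X b, if_pos hb])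
    (fun b => ⟨(hcl b).1, (hcl b).2.1, (hcl b).2.2.1⟩) (fun b hb => ?_)
  have hM := norm_chartMatJc_cutTo_recordGkL_le F θ k K hk hε hd2 a y X b hb (hcl b).2.2.2
  refine hM.trans (le_of_eq ?_)
  have hη3 : ((F.P K).eta (k + 1))⁻¹ ^ 3 * (C * (F.P K).eta (k + 1) ^ 3) = C := by
    field_simp
  calc 2 * ‖LinearMap.toContinuousLinearMap (sl2Proj.restrictScalars ℝ)‖ * ((F.P K).eta (k + 1))⁻¹ ^ 3 *
        (C * (F.P K).eta (k + 1) ^ 3 * Real.exp (-(δ₉ * (Site.tdist (coarsenTo (k + 1) b.src) y.2 : ℝ))))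
      = 2 * ‖LinearMap.toContinuousLinearMap (sl2Proj.restrictScalars ℝ)‖ * (((F.P K).eta (k + 1))⁻¹ ^ 3 * (C * (F.P K).eta (k + 1) ^ 3)) *
          Real.exp (-(δ₉ * (Site.tdist (coarsenTo (k + 1) b.src) y.2 : ℝ))) := by ring
    _ = 2 * ‖LinearMap.toContinuousLinearMap (sl2Proj.restrictScalars ℝ)‖ * C * Real.exp (-(δ₉ * (Site.tdist (coarsenTo (k + 1) b.src) y.2 : ℝ))) := by rw [hη3]

/-! ## §5  The `Response9D` frame for the L-layer data -/

variable {F} in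
/-- **`Response9D` FOR THE L-LAYER DATA FROM ITS TWO DECAY ROWS**: (R0) from the constants' signs, (R3)(R5) by ✓p796246 (`recordResponse9DataFromL`'s index∕window∕chart fields ARE
`…FromJ`'s), (R1ᴰ)(R4ᴰ) displayed. [cite: Balaban1985Variational, Prop. 9 p.309; Balaban1987RG1, (1.21) p.264, (4.35) p.290] -/
theorem response9D_fromL_of_decayRows {Mc : ℕ} (hMc : McGuard F Mc) (θ : Stage13Params F 2) (a : θ.ιβ) (k : ℕ) {α₂ C₉ δ₀ : ℝ}
    (hC : 0 ≤ C₉) (hδ : 0 ≤ δ₀)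
    (hR1 : ∀ (n : ℕ) (X : (recordDomSys F Mc k (recordK₀ F Mc k + n)).Dom) (y : RespLabel F k (recordK₀ F Mc k + n)),
      gauge (recordDom44J F Mc k (recordK₀ F Mc k + n) X α₂)
        (B12FormatPlus.cutTo (recordCXJ F Mc k (recordK₀ F Mc k + n) X) (recordGkL F θ k (recordK₀ F Mc k + n) a y)) ≤
        C₉ * Real.exp (-δ₀ * (recordSiteGeom F Mc k (recordK₀ F Mc k + n)).distD y X))
    (hR4 : ∀ (n : ℕ) (X : (recordDomSys F Mc k (recordK₀ F Mc k + n)).Dom), X ∉ recordWrapCtr F Mc k (recordK₀ F Mc k + n) →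
      ∀ (μ : Fin 4) (z : Fin 4 → ℤ), (∀ l, 2 * |z l| < (recordRNat F Mc k (recordK₀ F Mc k + n) : ℤ)) →
      gauge (recordDom44J F Mc k (recordK₀ F Mc k + n) X α₂)
        (B12FormatPlus.cutTo (recordCXJ F Mc k (recordK₀ F Mc k + n) X) fun i =>
          recordGkL F θ k (recordK₀ F Mc k + (n + 1)) a (recordE F k (recordK₀ F Mc k + (n + 1)) μ z) (recordJXJ F (recordK₀ F Mc k + n) i) -
            recordGkL F θ k (recordK₀ F Mc k + n) a (recordE F k (recordK₀ F Mc k + n) μ z) i) ≤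
        C₉ * Real.exp (-δ₀ * (recordRNat F Mc k (recordK₀ F Mc k + n) : ℝ) / 2) *
          Real.exp (-(δ₀ / 2) * (recordSiteGeom F Mc k (recordK₀ F Mc k + n)).distD (recordE F k (recordK₀ F Mc k + n) μ z) X)) :
    B12FormatPlus.Response9D (recordResponse9DataFromL F θ a Mc k (recordK₀ F Mc k)) (fun n => recordChartJ F Mc k (recordK₀ F Mc k + n))
      (fun n => recordRNat F Mc k (recordK₀ F Mc k + n)) (fun n X => recordDom44J F Mc k (recordK₀ F Mc k + n) X α₂) C₉ δ₀ :=
  ⟨hC, hδ, hR1, fun n X hX _ hi => rowR3_fromJ hMc θ a k n X hX hi, hR4, fun n X hX w' => rowR5_fromJ hMc θ a k n X hX w'⟩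

end Summit.QuantumFields.YangMills.Theorems.PortU8

end
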